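import Summits.QuantumFields.YangMills.Theorems.UnitScaleTiltProp7CurvedLandauCoreFibreFinalT3
import HarnessLib

/-!
# Route `UnitScaleTilt`, crux K1 «MinimiserStabilityRegPr» (stmt-QuantumFields-19200), route-R [RP] curved — THE RELATIVE POINCARÉ INEQUALITY ON THE NONLINEAR (0.4)-FIBRE
# IN CONSUMER FORM: `((1∕8)ℓ⁻² − (18 + 537600L⁴)δ)·Σ‖WU₀* − 1‖² − (18 + 537600L⁴)·Z ≤ (18 + 537600L⁴)·4·Σ_p‖W(∂p)U₀(∂p)* − 1‖²` (no auxiliary sup), and for the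
# covariant LANDAU representative (`D^*_{U₀}(WU₀* − 1) = 0`, the (Λ) line of RULING №25): `Σ_b‖W_bU₀,b* − 1‖² ≤ 32·(18 + 537600L⁴)·ℓ²·Σ_p‖W(∂p)U₀(∂p)* − 1‖²` — k- and volume-UNIFORM

Cell `ym3-torus`, D-0154 (3c) twin-width seat `ym-routeR-w3` (gen 2); corollaries of ✓ `…CurvedLandauCoreFibreFinalT3.relPoincare_on_fibre_T3`.  THEOREMS ONLY (0 `def`,
0 `sorry`); `--supports stmt-QuantumFields-19200`, count-neutral.  YM₃ on T³ is a ladder rung (R3), not the Clay problem; nothing here claims the stub, the crux, d = 4 or the gap.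

THE POINT.  ✓ `relPoincare_on_fibre_T3` carries the bondwise sup `‖WU₀* − 1‖ ≤ s ≤ 1` of ✓ p605008's (ii′) conversion and the term `(18+537600L⁴)(24576s² + 768(εℓ⁻²)²)` on
the left.  Since `U₀,b` is unitary, `‖W_bU₀,b* − 1‖ = ‖W_b − U₀,b‖ ≤ ρ_W`, so `s := ρ_W`; under the standing numerals `2·10¹¹L⁹(ℓρ_W) ≤ 1`, `10¹⁴L⁹ε ≤ 1` that term is at most
`(1∕8)ℓ⁻²` (§1 `absorb_sup`, small context), leaving `(1∕8)ℓ⁻²`.  With `D^*_{U₀}(WU₀* − 1) = 0` pointwise the divergence budget is `δ = Z = 0` and the inequality becomes the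
relative Poincaré inequality of the (Λ) line with the explicit constant `32·(18 + 537600L⁴)·ℓ²` (§2).

WHAT IS PROVED (ns `…Theorems.Prop7CurvedLandauCoreFibreLandauT3`).
* §1 `absorb_sup` (pure reals); `norm_pertVar_le_of_sub_le` (`‖WU₀* − 1‖ ≤ ρ_W` from `‖W − U₀‖ ≤ ρ_W`, unitarity); `rhoW_le_one`.
* §2 ★★★ `relPoincare_on_fibre_budget_T3` (general budget `(δ, Z)`), ★★★ `relPoincare_landau_fibre_T3` (Landau representative).
DISPLAYED (honest): the (14)-type plaquette bound of `U₀` at scale `ℓ = L^{K−n}` with `10¹⁴L⁹ε ≤ 1`; the fibre identity `W̄^{(K−n)} = Ū₀^{(K−n)}`; the competitor sup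
`‖W_e − U₀,e‖ ≤ ρ_W` with `2·10¹¹L⁹(ℓρ_W) ≤ 1`; and either the divergence budget `(δ, Z)` or the pointwise Landau condition.  NOT stub P (pinned text misstated-as-uniform, №25);
closes no item; the EXISTENCE of a Landau representative on the fibre ((FV-u-a)∕(S) of №25) is not asserted here.

References: T. Bałaban, CMP 99 (1985) 389–434 [Balaban1985BackgroundPropagators] (Thm 3.11 p.416); CMP 102 (1985) 277–309 [Balaban1985Variational] ((14)–(15) p.280,
(141)–(143) p.299, Prop. 7 p.299); CMP 98 (1985) 17–51 [Balaban1985Averaging] ((19) p.21, Prop. 3 (122)–(126) p.36).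
-/

set_option autoImplicit false

noncomputable section

open scoped BigOperators Matrix.Norms.L2Operator Matrix

namespace Summit.QuantumFields.YangMills.Theorems.Prop7CurvedLandauCoreFibreLandauT3

open Literature.MathematicalPhysics.QuantumFieldTheory.Balaban1983to89
open Literature.MathematicalPhysics.QuantumFieldTheory.Balaban1983to89.T3ContinuumYM3Torus
open Finset T4Continuum T4ReflectionCone BlockAveraging AveragingRT ExpMeanLog BlockAveragingEMLLinearised BlockAveragingEMLLinearisedBackground
  BlockAveragingEMLProp2 B1RG242Torus
open B9Eq39Adjoint (curl divB)
open B10Eq27TorusAxialLog (holT unitsField toUField)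
open B9TorusCalculus (torusT)
open Summit.QuantumFields.YangMills.Theorems.Prop7CurvedLandauKnitT3 (three_le_L)
open Summit.QuantumFields.YangMills.Theorems.Prop7CurvedLandauCoreFibreFinalT3 (relPoincare_on_fibre_T3)

/-! ## §1 Scalars and the unitary bond identity -/

/-- THE SCALAR ABSORPTION OF THE (ii′) SUP TERMS (pure reals): with `ℓ ≥ 1`, `L ≥ 3`, `2·10¹¹L⁹(ℓρ) ≤ 1`, `10¹⁴L⁹ε ≤ 1`, `M ≥ 0`:
`(18 + 537600L⁴)·(24576ρ² + 768(εℓ⁻²)²)·M ≤ (1∕8)·ℓ⁻²·M`. [folklore] -/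
theorem absorb_sup {ℓ L ε ρ M : ℝ} (hℓ : 1 ≤ ℓ) (hL : 3 ≤ L) (hε : 0 ≤ ε) (hρ : 0 ≤ ρ) (hM : 0 ≤ M)
    (hεL : 100000000000000 * L ^ 9 * ε ≤ 1) (hρW : 200000000000 * L ^ 9 * (ℓ * ρ) ≤ 1) :
    (18 + 537600 * L ^ 4) * (24576 * ρ ^ 2 + 768 * (ε * (ℓ ^ 2)⁻¹) ^ 2) * M ≤ (1 / 8) * (ℓ ^ 2)⁻¹ * M := by
  have hL1 : (1 : ℝ) ≤ L := by linarith
  have hℓ2 : 0 < ℓ ^ 2 := by positivity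
  have hX0 : 0 ≤ (ℓ ^ 2)⁻¹ := by positivity
  have hX1 : (ℓ ^ 2)⁻¹ ≤ 1 := inv_le_one_of_one_le₀ (one_le_pow₀ hℓ)
  have hA0 : 0 ≤ 18 + 537600 * L ^ 4 := by positivity
  have hA : 18 + 537600 * L ^ 4 ≤ 537618 * L ^ 18 := by
    have h4 : (1 : ℝ) ≤ L ^ 4 := one_le_pow₀ hL1
    have h418 : L ^ 4 ≤ L ^ 18 := pow_le_pow_right₀ hL1 (by norm_num)
    linarith
  -- (i) the `ρ²` term
  have hv0 : 0 ≤ 200000000000 * L ^ 9 * (ℓ * ρ) := by positivity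
  have hsq : (200000000000 * L ^ 9 * (ℓ * ρ)) ^ 2 ≤ 1 := by nlinarith
  have hT1 : (18 + 537600 * L ^ 4) * 24576 * ρ ^ 2 ≤ (1 / 16) * (ℓ ^ 2)⁻¹ := by
    rw [le_mul_inv_iff₀ hℓ2]
    have hcoef : 393216 * (18 + 537600 * L ^ 4) ≤ 40000000000000000000000 * L ^ 18 := by nlinarith [hA]
    nlinarith [mul_nonneg (sub_nonneg.2 hcoef) (sq_nonneg (ℓ * ρ)), hsq]
  -- (ii) the `ε²` term
  have hw0 : 0 ≤ 100000000000000 * L ^ 9 * ε := by positivity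
  have hεsq : (100000000000000 * L ^ 9 * ε) ^ 2 ≤ 1 := by nlinarith
  have hT2a : (18 + 537600 * L ^ 4) * 768 * ε ^ 2 ≤ 1 / 16 := by
    nlinarith [mul_le_mul_of_nonneg_right hA (sq_nonneg ε), hεsq]
  have hT2 : (18 + 537600 * L ^ 4) * 768 * (ε * (ℓ ^ 2)⁻¹) ^ 2 ≤ (1 / 16) * (ℓ ^ 2)⁻¹ := by
    have h1 : (18 + 537600 * L ^ 4) * 768 * ε ^ 2 * (ℓ ^ 2)⁻¹ ≤ 1 / 16 := by
      calc (18 + 537600 * L ^ 4) * 768 * ε ^ 2 * (ℓ ^ 2)⁻¹ ≤ (18 + 537600 * L ^ 4) * 768 * ε ^ 2 * 1 :=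
            mul_le_mul_of_nonneg_left hX1 (by positivity)
        _ ≤ 1 / 16 := by linarith
    have h2 := mul_le_mul_of_nonneg_right h1 hX0
    calc (18 + 537600 * L ^ 4) * 768 * (ε * (ℓ ^ 2)⁻¹) ^ 2 = (18 + 537600 * L ^ 4) * 768 * ε ^ 2 * (ℓ ^ 2)⁻¹ * (ℓ ^ 2)⁻¹ := by ring
      _ ≤ 1 / 16 * (ℓ ^ 2)⁻¹ := h2
  have hsum : (18 + 537600 * L ^ 4) * (24576 * ρ ^ 2 + 768 * (ε * (ℓ ^ 2)⁻¹) ^ 2) ≤ (1 / 8) * (ℓ ^ 2)⁻¹ := by linarith [hT1, hT2]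
  exact mul_le_mul_of_nonneg_right hsum hM

/-- `‖W_bU₀,b* − 1‖ ≤ ρ_W` from `‖W_b − U₀,b‖ ≤ ρ_W` (`U₀,b` unitary: `WU₀* − 1 = (W − U₀)U₀*`). [cite: Balaban1985Averaging, (19) p.21] -/
theorem norm_pertVar_le_of_sub_le {P : Params} (U₀ W : GaugeField P 0 (Matrix.specialUnitaryGroup (Fin 2) ℂ)) {ρW : ℝ}
    (hW : ∀ e : PBond P 0, ‖((W e : Matrix.specialUnitaryGroup (Fin 2) ℂ) : Matrix (Fin 2) (Fin 2) ℂ) - ((U₀ e : Matrix.specialUnitaryGroup (Fin 2) ℂ) : Matrix (Fin 2) (Fin 2) ℂ)‖ ≤ ρW) (b : PBond P 0) :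
    ‖pertVar U₀ W b‖ ≤ ρW := by
  rw [pertVar_eq]
  have hB : ((U₀ b : Matrix.specialUnitaryGroup (Fin 2) ℂ) : Matrix (Fin 2) (Fin 2) ℂ) * star ((U₀ b : Matrix.specialUnitaryGroup (Fin 2) ℂ) : Matrix (Fin 2) (Fin 2) ℂ) = 1 :=
    Unitary.mul_star_self_of_mem (U₀ b).2.1
  have e : ((W b : Matrix.specialUnitaryGroup (Fin 2) ℂ) : Matrix (Fin 2) (Fin 2) ℂ) * star ((U₀ b : Matrix.specialUnitaryGroup (Fin 2) ℂ) : Matrix (Fin 2) (Fin 2) ℂ) - 1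
      = (((W b : Matrix.specialUnitaryGroup (Fin 2) ℂ) : Matrix (Fin 2) (Fin 2) ℂ) - ((U₀ b : Matrix.specialUnitaryGroup (Fin 2) ℂ) : Matrix (Fin 2) (Fin 2) ℂ)) * star ((U₀ b : Matrix.specialUnitaryGroup (Fin 2) ℂ) : Matrix (Fin 2) (Fin 2) ℂ) := by
    rw [sub_mul, hB]
  rw [e, CStarRing.norm_mul_mem_unitary _ (Unitary.star_mem (U₀ b).2.1)]
  exact hW b

/-- `ρ_W ≤ 1` from `2·10¹¹L⁹(ℓρ_W) ≤ 1` (`L ≥ 3`, `ℓ = L^{K−n} ≥ 1`). [folklore] -/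
theorem rhoW_le_one (F : T3Family) (n K : ℕ) {ρW : ℝ} (hρ0 : 0 ≤ ρW) (hρW : 200000000000 * (F.L : ℝ) ^ 9 * (((F.L : ℝ) ^ (K - n)) * ρW) ≤ 1) :
    ρW ≤ 1 := by
  have hL3 := three_le_L F
  have hL1 : (1 : ℝ) ≤ (F.L : ℝ) := by linarith
  have hL9 : (1 : ℝ) ≤ (F.L : ℝ) ^ 9 := one_le_pow₀ hL1
  have hℓ1 : (1 : ℝ) ≤ (F.L : ℝ) ^ (K - n) := one_le_pow₀ hL1
  have h2 : ρW ≤ (F.L : ℝ) ^ (K - n) * ρW := le_mul_of_one_le_left hρ0 hℓ1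
  have h1 : (F.L : ℝ) ^ (K - n) * ρW ≤ (F.L : ℝ) ^ 9 * ((F.L : ℝ) ^ (K - n) * ρW) := le_mul_of_one_le_left (by positivity) hL9
  linarith

/-! ## §2 ★★★ The consumer forms -/

set_option maxHeartbeats 400000 in
/-- ★★★ **THE RELATIVE POINCARÉ INEQUALITY ON THE FIBRE, BUDGET FORM (d = 3, `SU(2)`).**  `U₀, W` on the finest torus of run `K` with `W̄^{(K−n)} = Ū₀^{(K−n)}`;
`dist1(U₀(∂p)) ≤ εℓ⁻²` (`ℓ = L^{K−n}`, `0 < ε`, `10¹⁴L⁹ε ≤ 1`); `‖W_e − U₀,e‖ ≤ ρ_W` bondwise, `2·10¹¹·L⁹·(ℓρ_W) ≤ 1`; `Σ‖D^*_{U₀}(WU₀* − 1)‖²_HS ≤ δΣ‖WU₀* − 1‖² + Z`.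
THEN `((1∕8)ℓ⁻² − (18 + 537600L⁴)δ)·Σ_b‖W_bU₀,b* − 1‖² − (18 + 537600L⁴)·Z ≤ (18 + 537600L⁴)·4·Σ_p‖W(∂p)U₀(∂p)* − 1‖²`.
[cite: Balaban1985Variational, (141)-(143) p.299, Prop. 7 p.299; Balaban1985BackgroundPropagators, Thm 3.11 p.416; Balaban1985Averaging, Prop. 3 (122)-(126) p.36] -/
theorem relPoincare_on_fibre_budget_T3 (F : T3Family) (n K : ℕ)
    (U₀ W : GaugeField (F.P K) 0 (Matrix.specialUnitaryGroup (Fin 2) ℂ)) {ε : ℝ} (hε : 0 < ε) (hεL : 100000000000000 * (F.L : ℝ) ^ 9 * ε ≤ 1)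
    (hU : ∀ p : Plaq (F.P K) 0, dist1 (GaugeField.plaqHol U₀ p) ≤ ε * (((F.L : ℝ) ^ (K - n)) ^ 2)⁻¹)
    (hfib : Averaging.iter (fun i => blockAvg (P := (F.P K)) (j := i) (expMeanLogSU (n := Fin 2))) (K - n) W = Averaging.iter (fun i => blockAvg (P := (F.P K)) (j := i) (expMeanLogSU (n := Fin 2))) (K - n) U₀)
    {δ Z : ℝ}
    (hdivB : (∑ x : Site (F.P K) 0, ∑ j : Fin 2, ∑ k : Fin 2,
            ‖(divB (torusT (F.P K) 0) (fun κ z => unitsField (toUField U₀) ⟨z, κ⟩) (fun κ z => pertVar U₀ W ⟨z, κ⟩) x) j k‖ ^ 2)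
      ≤ δ * (∑ b : PBond (F.P K) 0, ‖pertVar U₀ W b‖ ^ 2) + Z)
    {ρW : ℝ} (hρ0 : 0 ≤ ρW) (hρW : 200000000000 * (F.L : ℝ) ^ 9 * (((F.L : ℝ) ^ (K - n)) * ρW) ≤ 1)
    (hW : ∀ e : PBond (F.P K) 0, ‖((W e : Matrix.specialUnitaryGroup (Fin 2) ℂ) : Matrix (Fin 2) (Fin 2) ℂ) - ((U₀ e : Matrix.specialUnitaryGroup (Fin 2) ℂ) : Matrix (Fin 2) (Fin 2) ℂ)‖ ≤ ρW) :
    ((1 / 8) * ((((F.L : ℝ) ^ (K - n))) ^ 2)⁻¹ - (18 + 537600 * (F.L : ℝ) ^ 4) * δ) * (∑ b : PBond (F.P K) 0, ‖pertVar U₀ W b‖ ^ 2) - (18 + 537600 * (F.L : ℝ) ^ 4) * Z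
      ≤ (18 + 537600 * (F.L : ℝ) ^ 4) * (4 * ∑ p : Plaq (F.P K) 0,
        ‖((GaugeField.plaqHol W p : Matrix.specialUnitaryGroup (Fin 2) ℂ) : Matrix (Fin 2) (Fin 2) ℂ)
          * star ((GaugeField.plaqHol U₀ p : Matrix.specialUnitaryGroup (Fin 2) ℂ) : Matrix (Fin 2) (Fin 2) ℂ) - 1‖ ^ 2) := by
  have hL3 := three_le_L F
  have hL1 : (1 : ℝ) ≤ (F.L : ℝ) := by linarith only [hL3]
  have hℓ1 : (1 : ℝ) ≤ (F.L : ℝ) ^ (K - n) := one_le_pow₀ hL1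
  have hs1 := rhoW_le_one F n K hρ0 hρW
  have hδW := norm_pertVar_le_of_sub_le U₀ W hW
  have h := relPoincare_on_fibre_T3 F n K U₀ W hε hεL hU hfib hdivB hρ0 hρW hW hδW hs1
  have hab := absorb_sup hℓ1 hL3 hε.le hρ0 (Finset.sum_nonneg fun _ _ => sq_nonneg _ : (0 : ℝ) ≤ (∑ b : PBond (F.P K) 0, ‖pertVar U₀ W b‖ ^ 2)) hεL hρW
  linarith only [h, hab]

set_option maxHeartbeats 400000 in
/-- ★★★ **THE RELATIVE POINCARÉ INEQUALITY FOR THE COVARIANT LANDAU REPRESENTATIVE ON THE FIBRE (d = 3, `SU(2)`): the (Λ) line's curved core.**  As above, with the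
divergence budget replaced by the pointwise Landau condition `D^*_{U₀}(WU₀* − 1)(x) = 0`.  THEN
`Σ_b‖W_bU₀,b* − 1‖² ≤ 32·(18 + 537600L⁴)·ℓ²·Σ_p‖W(∂p)U₀(∂p)* − 1‖²` — the constant is k- and volume-independent.
[cite: Balaban1985Variational, (141)-(143) p.299, Prop. 7 p.299; Balaban1985BackgroundPropagators, Thm 3.11 p.416] -/
theorem relPoincare_landau_fibre_T3 (F : T3Family) (n K : ℕ)
    (U₀ W : GaugeField (F.P K) 0 (Matrix.specialUnitaryGroup (Fin 2) ℂ)) {ε : ℝ} (hε : 0 < ε) (hεL : 100000000000000 * (F.L : ℝ) ^ 9 * ε ≤ 1)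
    (hU : ∀ p : Plaq (F.P K) 0, dist1 (GaugeField.plaqHol U₀ p) ≤ ε * (((F.L : ℝ) ^ (K - n)) ^ 2)⁻¹)
    (hfib : Averaging.iter (fun i => blockAvg (P := (F.P K)) (j := i) (expMeanLogSU (n := Fin 2))) (K - n) W = Averaging.iter (fun i => blockAvg (P := (F.P K)) (j := i) (expMeanLogSU (n := Fin 2))) (K - n) U₀)
    (hLandau : ∀ x : Site (F.P K) 0, divB (torusT (F.P K) 0) (fun κ z => unitsField (toUField U₀) ⟨z, κ⟩) (fun κ z => pertVar U₀ W ⟨z, κ⟩) x = 0)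
    {ρW : ℝ} (hρ0 : 0 ≤ ρW) (hρW : 200000000000 * (F.L : ℝ) ^ 9 * (((F.L : ℝ) ^ (K - n)) * ρW) ≤ 1)
    (hW : ∀ e : PBond (F.P K) 0, ‖((W e : Matrix.specialUnitaryGroup (Fin 2) ℂ) : Matrix (Fin 2) (Fin 2) ℂ) - ((U₀ e : Matrix.specialUnitaryGroup (Fin 2) ℂ) : Matrix (Fin 2) (Fin 2) ℂ)‖ ≤ ρW) :
    (∑ b : PBond (F.P K) 0, ‖pertVar U₀ W b‖ ^ 2) ≤ 32 * (18 + 537600 * (F.L : ℝ) ^ 4) * (((F.L : ℝ) ^ (K - n))) ^ 2 * (∑ p : Plaq (F.P K) 0,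
        ‖((GaugeField.plaqHol W p : Matrix.specialUnitaryGroup (Fin 2) ℂ) : Matrix (Fin 2) (Fin 2) ℂ)
          * star ((GaugeField.plaqHol U₀ p : Matrix.specialUnitaryGroup (Fin 2) ℂ) : Matrix (Fin 2) (Fin 2) ℂ) - 1‖ ^ 2) := by
  have hL3 := three_le_L F
  have hℓ2 : 0 < (((F.L : ℝ) ^ (K - n))) ^ 2 := by positivity
  have hz : (∑ x : Site (F.P K) 0, ∑ j : Fin 2, ∑ k : Fin 2,
            ‖(divB (torusT (F.P K) 0) (fun κ z => unitsField (toUField U₀) ⟨z, κ⟩) (fun κ z => pertVar U₀ W ⟨z, κ⟩) x) j k‖ ^ 2) = 0 := by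
    refine Finset.sum_eq_zero fun x _ => ?_
    rw [hLandau x]
    simp
  have hdivB : (∑ x : Site (F.P K) 0, ∑ j : Fin 2, ∑ k : Fin 2,
            ‖(divB (torusT (F.P K) 0) (fun κ z => unitsField (toUField U₀) ⟨z, κ⟩) (fun κ z => pertVar U₀ W ⟨z, κ⟩) x) j k‖ ^ 2)
      ≤ 0 * (∑ b : PBond (F.P K) 0, ‖pertVar U₀ W b‖ ^ 2) + 0 := by
    rw [hz, zero_mul, add_zero]
  have h := relPoincare_on_fibre_budget_T3 F n K U₀ W hε hεL hU hfib hdivB hρ0 hρW hW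
  have e : 8 * (((F.L : ℝ) ^ (K - n))) ^ 2 * ((1 / 8) * ((((F.L : ℝ) ^ (K - n))) ^ 2)⁻¹ * (∑ b : PBond (F.P K) 0, ‖pertVar U₀ W b‖ ^ 2))
      = (∑ b : PBond (F.P K) 0, ‖pertVar U₀ W b‖ ^ 2) := by
    rw [show 8 * (((F.L : ℝ) ^ (K - n))) ^ 2 * ((1 / 8) * ((((F.L : ℝ) ^ (K - n))) ^ 2)⁻¹ * (∑ b : PBond (F.P K) 0, ‖pertVar U₀ W b‖ ^ 2))
        = ((((F.L : ℝ) ^ (K - n))) ^ 2 * ((((F.L : ℝ) ^ (K - n))) ^ 2)⁻¹) * (∑ b : PBond (F.P K) 0, ‖pertVar U₀ W b‖ ^ 2) by ring, mul_inv_cancel₀ hℓ2.ne', one_mul]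
  have h' : (1 / 8) * ((((F.L : ℝ) ^ (K - n))) ^ 2)⁻¹ * (∑ b : PBond (F.P K) 0, ‖pertVar U₀ W b‖ ^ 2) ≤ (18 + 537600 * (F.L : ℝ) ^ 4) * (4 * ∑ p : Plaq (F.P K) 0,
        ‖((GaugeField.plaqHol W p : Matrix.specialUnitaryGroup (Fin 2) ℂ) : Matrix (Fin 2) (Fin 2) ℂ)
          * star ((GaugeField.plaqHol U₀ p : Matrix.specialUnitaryGroup (Fin 2) ℂ) : Matrix (Fin 2) (Fin 2) ℂ) - 1‖ ^ 2) := by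
    linarith only [h]
  have h2 := mul_le_mul_of_nonneg_left h' (by positivity : (0 : ℝ) ≤ 8 * (((F.L : ℝ) ^ (K - n))) ^ 2)
  rw [e] at h2
  linarith only [h2]

end Summit.QuantumFields.YangMills.Theorems.Prop7CurvedLandauCoreFibreLandauT3

end
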